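import Literature.AlgebraicGeometry.Resolution.EmbeddedResolutionExcellentSurfacesResolutionCodim
import Literature.AlgebraicGeometry.Resolution.ArithmeticalThreefoldsLocalRankReduction
import Literature.AlgebraicGeometry.Resolution.AdicCompletionRegular
import Literature.AlgebraicGeometry.Resolution.ProjectiveSpaceRegular
import Literature.AlgebraicGeometry.Resolution.CofinalityFromPrincipalization
import Mathlib.RingTheory.Ideal.KrullsHeightTheorem
import Mathlib.RingTheory.Polynomial.Ideal
import HarnessLib

/-!
# Cossart–Piltant 2019, Prop. 4.10: regular models in dimension `≤ 2` from CJS Thm. 1.4 (`B = ∅`) alone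

Topic: `Literature/AlgebraicGeometry/Resolution` (proofs only: no new notions, no new named facts).

The rank-one reduction (C5) of the proof of Cossart–Piltant 2019, Prop. 4.10
(`ArithmeticalThreefoldsLocalRankReduction.lean`) uses resolution of excellent surfaces through ONE lemma,
`exists_model_regular_of_cjs`: a finitely generated model `R ⊆ O'` over the base ring whose local ring at the
centre `P'` of the valuation ring `O'` is excellent of dimension `≤ 2` can be enlarged to a finitely generated
model regular at the centre — proved there from the NON-embedded theorem `CossartJannsenSaito2020General`
(CJS Thm. 1.2 for arbitrary reduced excellent schemes of dimension `≤ 2`).  This file proves the same lemma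
from the EMBEDDED theorem `CossartJannsenSaito2020Embedded` (CJS Thm. 1.4, `B = ∅`) when the base ring `S` is
a regular Noetherian domain which is excellent — the situation of Prop. 4.10 (`S` an excellent regular local
ring):

* `CossartJannsenSaito2020Embedded.hasResolution_Spec_of_surjective` — for a surjection `ψ : B → D` from an
  excellent regular Noetherian ring onto a domain of dimension `≤ 2` with `ht(ker ψ) ≥ 2`, `Spec D` admits a
  resolution of singularities (`EmbeddedResolutionExcellentSurfacesResolutionCodim.lean` applied to the closed
  immersion `Spec D ↪ Spec B`);
* `exists_model_regular_of_cjsEmbedded` — the lemma: `R_{P'}` is a quotient of the localization `B` of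
  `S[x_v : v ∈ t][Y][X]` (two extra variables, to make the codimension `≥ 2`: the primes `(X) ⊂ (X, Y)` survive in
  `B` and lie in the kernel) at the preimage of the centre; `B` is regular (Serre: localizations of regular rings,
  polynomial rings over regular rings), Noetherian and excellent (essentially of finite type over `S`); so `Spec R_{P'}`
  has a resolution, which uniformizes `O'` over `R_{P'}` (`exists_fg_regular_of_hasResolution`), and the regular
  finitely generated `R_{P'}`-model is read back as a model over `R` exactly as in `exists_model_regular_of_cjs`.

## Sources

* V. Cossart, O. Piltant, *Resolution of singularities of arithmetical threefolds*, J. Algebra 529 (2019),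
  proof of Prop. 4.10 (arXiv v1: Prop. 4.8, p. 53). [CossartPiltant2019]
* V. Cossart, U. Jannsen, S. Saito, LNM 2270 (2020), Thm. 1.4. [CossartJannsenSaito2020]
* J. Novacoski, M. Spivakovsky, *Reduction of local uniformization to the rank one case* (2014), Lemma 2.5 (1).
  [NovacoskiSpivakovsky2014]
-/

noncomputable section

open CategoryTheory AlgebraicGeometry IsLocalRing Polynomial

namespace Literature.AlgebraicGeometry.Resolution

universe u

/-! ## Resolution of `Spec` of a quotient of an excellent regular ring, codimension `≥ 2` -/

/-- **CJS Thm. 1.4 (`B = ∅`) ⇒ resolution of two-dimensional quotients of excellent regular rings in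
codimension `≥ 2`.** If `ψ : B → D` is a surjective ring map from an excellent regular Noetherian ring onto a
domain of Krull dimension `≤ 2` whose kernel has height `≥ 2`, then `Spec D` admits a resolution of singularities:
`Spec D ↪ Spec B` is a closed immersion of an integral scheme of dimension `≤ 2` into a Noetherian regular excellent
scheme, and the local ring of `Spec B` at the generic point of `Spec D` is `B_𝔮` with `𝔮 ⊇ ker ψ`, of dimension
`ht 𝔮 ≥ 2` (`CossartJannsenSaito2020Embedded.hasResolution_of_two_le_ringKrullDim`).
[cite: CossartJannsenSaito2020, Thm. 1.4 (pp. 5–6) and p. 7] -/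
theorem CossartJannsenSaito2020Embedded.hasResolution_Spec_of_surjective
    (hCJSE : CossartJannsenSaito2020Embedded.{u}) {B D : Type u} [CommRing B] [CommRing D] [IsDomain D]
    [IsRegularRing B] (hB : IsExcellentRing B) (ψ : B →+* D)
    (hψ : Function.Surjective ψ) (hdim : ringKrullDim D ≤ 2) (h2 : (2 : ℕ∞) ≤ (RingHom.ker ψ).height) :
    Scheme.HasResolution (Spec (.of D)) := by
  haveI : IsDomain (CommRingCat.of D) := ‹IsDomain D›
  haveI : IsRegularRing (CommRingCat.of B) := ‹IsRegularRing B›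
  haveI : IsNoetherianRing (CommRingCat.of B) := (inferInstance : IsNoetherianRing B)
  let i : Spec (.of D) ⟶ Spec (.of B) := Spec.map (CommRingCat.ofHom ψ)
  haveI : IsClosedImmersion i := IsClosedImmersion.spec_of_surjective _ hψ
  have hreg : Scheme.IsRegular (Spec (.of B)) := Scheme.isRegular_Spec (.of B)
  have hexc : Scheme.IsExcellent (Spec (.of B)) := Scheme.isExcellent_Spec_of_isExcellentRing B hB
  have hdim' : topologicalKrullDim (Spec (.of D)) ≤ 2 := by
    change topologicalKrullDim (PrimeSpectrum D) ≤ 2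
    rw [PrimeSpectrum.topologicalKrullDim_eq_ringKrullDim]
    exact hdim
  refine hCJSE.hasResolution_of_two_le_ringKrullDim i hreg hexc hdim' ?_
  -- the stalk at the generic point is `B_𝔮` with `𝔮 ⊇ ker ψ`
  set x₀ : Spec (.of B) := i (genericPoint (Spec (.of D))) with hx₀
  have hker : RingHom.ker ψ ≤ x₀.asIdeal := by
    rw [hx₀]
    change RingHom.ker ψ ≤ (PrimeSpectrum.comap ψ (genericPoint (Spec (.of D)))).asIdeal
    rw [PrimeSpectrum.comap_asIdeal, RingHom.ker_eq_comap_bot]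
    exact Ideal.comap_mono bot_le
  have e : Localization.AtPrime x₀.asIdeal ≃+* (Spec (.of B)).presheaf.stalk x₀ :=
    (StructureSheaf.stalkIso B x₀).toRingEquiv
  rw [← ringKrullDim_eq_of_ringEquiv e,
    IsLocalization.AtPrime.ringKrullDim_eq_height x₀.asIdeal (Localization.AtPrime x₀.asIdeal)]
  have h2' : (2 : ℕ∞) ≤ x₀.asIdeal.height := h2.trans (Ideal.height_mono hker)
  exact (WithBot.coe_le_coe (a := (2 : ℕ∞))).mpr h2'

/-! ## The engine: a local ring dominated by a localization of a regular ring, with two spare primes -/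

/-- **Engine** (private): let `A` be a regular domain all of whose localizations at primes are excellent, `D` a
local domain of dimension `≤ 2`, and `φ : A → D` a ring map through which every element of `D` is a fraction
`φ(a) / φ(s)` with `φ(s)` a unit; suppose primes `0 < 𝔭₁ < 𝔭₂` of `A` die under `φ`.  Then `Spec D` admits a
resolution of singularities: `D` is a quotient of `B = A_𝔓`, `𝔓 = φ⁻¹(𝔪_D)`, by an ideal containing the height-two
prime `𝔭₂ B`, and `CossartJannsenSaito2020Embedded.hasResolution_Spec_of_surjective` applies to `B ↠ D`.
[cite: CossartJannsenSaito2020, Thm. 1.4] -/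
private theorem hasResolution_Spec_of_localization_quotient
    (hCJSE : CossartJannsenSaito2020Embedded.{u}) {A D : Type u} [CommRing A] [IsDomain A]
    [IsRegularRing A] [CommRing D] [IsDomain D] [IsLocalRing D]
    (hA : ∀ (P : Ideal A) [P.IsPrime], IsExcellentRing (Localization.AtPrime P))
    (φ : A →+* D) (hφ : ∀ d : D, ∃ a s : A, IsUnit (φ s) ∧ d * φ s = φ a)
    (hdim : ringKrullDim D ≤ 2) {𝔭₁ 𝔭₂ : Ideal A} [𝔭₁.IsPrime] [𝔭₂.IsPrime]
    (h01 : ⊥ < 𝔭₁) (h12 : 𝔭₁ < 𝔭₂) (h2k : 𝔭₂ ≤ RingHom.ker φ) :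
    Scheme.HasResolution (Spec (.of D)) := by
  classical
  let Pp : Ideal A := (maximalIdeal D).comap φ
  haveI hPp : Pp.IsPrime := Ideal.IsPrime.comap _
  have hunits : ∀ y : Pp.primeCompl, IsUnit (φ y) := fun y =>
    IsLocalRing.notMem_maximalIdeal.mp y.2
  let ψ : Localization.AtPrime Pp →+* D := IsLocalization.lift hunits
  have hψalg : ∀ a, ψ (algebraMap A (Localization.AtPrime Pp) a) = φ a := fun a =>
    IsLocalization.lift_eq hunits a
  -- `ψ` is surjective
  have hψ : Function.Surjective ψ := by
    intro d
    obtain ⟨a, s, hs, hd⟩ := hφ d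
    have hsP : s ∈ Pp.primeCompl := fun hmem => (IsLocalRing.notMem_maximalIdeal.mpr hs) hmem
    refine ⟨IsLocalization.mk' (Localization.AtPrime Pp) a ⟨s, hsP⟩, ?_⟩
    have h1 : ψ (IsLocalization.mk' (Localization.AtPrime Pp) a ⟨s, hsP⟩) * φ s = φ a := by
      rw [← hψalg s, ← map_mul]
      have := IsLocalization.mk'_spec (Localization.AtPrime Pp) a ⟨s, hsP⟩
      dsimp only at this
      rw [this, hψalg]
    exact hs.mul_left_injective (h1.trans hd.symm)
  -- the primes `𝔭₁ B < 𝔭₂ B ≤ ker ψ`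
  have h2P : 𝔭₂ ≤ Pp := fun x hx => by
    change φ x ∈ maximalIdeal D
    rw [show φ x = 0 from h2k hx]
    exact Ideal.zero_mem _
  have h1P : 𝔭₁ ≤ Pp := h12.le.trans h2P
  have hdisj : ∀ I : Ideal A, I ≤ Pp → Disjoint (Pp.primeCompl : Set A) I := fun I hI =>
    Set.disjoint_left.mpr fun x hx hxI => hx (hI hxI)
  haveI h𝔭₁B : (𝔭₁.map (algebraMap A (Localization.AtPrime Pp))).IsPrime :=
    IsLocalization.isPrime_of_isPrime_disjoint Pp.primeCompl _ 𝔭₁ ‹_› (hdisj 𝔭₁ h1P)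
  haveI h𝔭₂B : (𝔭₂.map (algebraMap A (Localization.AtPrime Pp))).IsPrime :=
    IsLocalization.isPrime_of_isPrime_disjoint Pp.primeCompl _ 𝔭₂ ‹_› (hdisj 𝔭₂ h2P)
  have hc₁ : (𝔭₁.map (algebraMap A (Localization.AtPrime Pp))).under A = 𝔭₁ :=
    IsLocalization.under_map_of_isPrime_disjoint Pp.primeCompl _ ‹_› (hdisj 𝔭₁ h1P)
  have hc₂ : (𝔭₂.map (algebraMap A (Localization.AtPrime Pp))).under A = 𝔭₂ :=
    IsLocalization.under_map_of_isPrime_disjoint Pp.primeCompl _ ‹_› (hdisj 𝔭₂ h2P)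
  have h12B : 𝔭₁.map (algebraMap A (Localization.AtPrime Pp)) <
      𝔭₂.map (algebraMap A (Localization.AtPrime Pp)) := by
    refine lt_of_le_of_ne (Ideal.map_mono h12.le) fun h => h12.ne ?_
    rw [← hc₁, ← hc₂, h]
  have hinjB : Function.Injective (algebraMap A (Localization.AtPrime Pp)) :=
    IsLocalization.injective (Localization.AtPrime Pp) Pp.primeCompl_le_nonZeroDivisors
  have h01B : (⊥ : Ideal (Localization.AtPrime Pp)) < 𝔭₁.map (algebraMap A (Localization.AtPrime Pp)) := by
    obtain ⟨x, hx1, hx0⟩ : ∃ x ∈ 𝔭₁, x ≠ 0 := by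
      by_contra h
      push Not at h
      exact h01.ne (le_bot_iff.mp fun x hx => h x hx).symm
    refine bot_lt_iff_ne_bot.mpr fun h => hx0 (hinjB ?_)
    have hx : algebraMap A (Localization.AtPrime Pp) x ∈ 𝔭₁.map (algebraMap A _) :=
      Ideal.mem_map_of_mem _ hx1
    rw [h] at hx
    rw [(Submodule.mem_bot _).mp hx, map_zero]
  have hkerψ : 𝔭₂.map (algebraMap A (Localization.AtPrime Pp)) ≤ RingHom.ker ψ := by
    rw [Ideal.map_le_iff_le_comap]
    intro x hx
    change ψ (algebraMap A _ x) = 0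
    rw [hψalg]
    exact h2k hx
  have hh2 : (2 : ℕ∞) ≤ (RingHom.ker ψ).height := by
    have a1 := Ideal.height_strict_mono_of_isPrime h01B
    have a2 := Ideal.height_strict_mono_of_isPrime h12B
    rw [Ideal.height_bot] at a1
    have b1 : (1 : ℕ∞) ≤ (𝔭₁.map (algebraMap A (Localization.AtPrime Pp))).height :=
      Order.one_le_iff_ne_zero.mpr a1.ne'
    have b2 : (𝔭₁.map (algebraMap A (Localization.AtPrime Pp))).height + 1 ≤
        (𝔭₂.map (algebraMap A (Localization.AtPrime Pp))).height := Order.add_one_le_of_lt a2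
    have b3 : (1 : ℕ∞) + 1 ≤ (𝔭₂.map (algebraMap A (Localization.AtPrime Pp))).height :=
      le_trans (by gcongr) b2
    exact b3.trans (Ideal.height_mono hkerψ)
  -- `B` is regular and excellent
  haveI : IsRegularRing (Localization.AtPrime Pp) := isRegularRing_localization_atPrime A Pp
  exact hCJSE.hasResolution_Spec_of_surjective (hA Pp) ψ hψ hdim hh2

/-! ## Regular models in dimension `≤ 2` over a regular excellent base -/

section ModelOfDimLeTwo

variable {S K : Type u} [CommRing S] [IsDomain S] [IsRegularRing S] [Field K] [Algebra S K]

/-- **Regular models in dimension `≤ 2` from CJS Thm. 1.4 (`B = ∅`)**: let `S` be a regular Noetherian excellent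
domain and `R ⊆ O'` a finitely generated `S`-subalgebra of the field `K = Frac R` inside a valuation ring `O'`,
with centre `P' = 𝔪_{O'} ∩ R`.  If `R_{P'}` has dimension `≤ 2`, then some finitely generated `A₁ ⊇ R` inside `O'`
is regular at the centre of `O'`.  Writing `R = S[t]`, the local ring `R_{P'}` is a quotient of the localization
`B` of `S[t][Y][X]` at the preimage of the centre, by an ideal containing the height-two prime `(X, Y)B`; `B` is
regular, Noetherian and excellent, so `Spec R_{P'}` has a resolution
(`CossartJannsenSaito2020Embedded.hasResolution_Spec_of_surjective`), hence `O'` is uniformized by a finitely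
generated regular `R_{P'}`-model `T = R_{P'}[g]` (`exists_fg_regular_of_hasResolution`), and `A₁ = R[g]` has the
same local ring at the centre (Novacoski–Spivakovsky, Lemma 2.5 (1)) — as in `exists_model_regular_of_cjs`.
[cite: CossartJannsenSaito2020, Thm. 1.4] [cite: NovacoskiSpivakovsky2014, Lemma 2.5 (1)]
[cite: CossartPiltant2019, proof of Prop. 4.10 (arXiv v1: Prop. 4.8, p. 53)] -/
theorem exists_model_regular_of_cjsEmbedded (hCJSE : CossartJannsenSaito2020Embedded.{u})
    (hS : IsExcellentRing S)
    (O' : ValuationSubring K) (R : Subalgebra S K) (hRfg : R.FG) [IsNoetherianRing R]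
    [IsFractionRing R K] (hRO : R.toSubring ≤ O'.toSubring)
    (P' : Ideal R) [P'.IsPrime] (hP' : ∀ z : R, z ∈ P' ↔ O'.valuation (z : K) < 1)
    (hdim : ringKrullDim (Localization.AtPrime P') ≤ 2) :
    ∃ (A₁ : Subalgebra S K) (hA₁ : A₁.toSubring ≤ O'.toSubring), R ≤ A₁ ∧ A₁.FG ∧
      IsRegularLocalRing
        (Localization.AtPrime ((maximalIdeal O').comap (Subring.inclusion hA₁))) := by
  classical
  -- the local ring `D = R_{P'}` realised inside `K`
  let D : Subalgebra R K :=
    Localization.subalgebra.ofField K P'.primeCompl P'.primeCompl_le_nonZeroDivisors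
  haveI : IsLocalization.AtPrime D P' :=
    Localization.subalgebra.isLocalization_ofField K P'.primeCompl P'.primeCompl_le_nonZeroDivisors
  let e : Localization.AtPrime P' ≃ₐ[R] D :=
    IsLocalization.algEquiv P'.primeCompl (Localization.AtPrime P') D
  haveI : IsNoetherianRing D := isNoetherianRing_of_ringEquiv _ e.toRingEquiv
  haveI : IsLocalRing D := IsLocalization.AtPrime.isLocalRing D P'
  have hdimD : ringKrullDim D ≤ 2 := by
    rw [← ringKrullDim_eq_of_ringEquiv e.toRingEquiv]; exact hdim
  haveI : IsFractionRing D K :=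
    IsFractionRing.isFractionRing_of_isDomain_of_isLocalization P'.primeCompl D K
  have hmemD : ∀ x : K, x ∈ D ↔ ∃ a : R, ∃ s : R, s ∉ P' ∧ x = (a : K) * ((s : K))⁻¹ := by
    intro x
    change (∃ (a s : R) (_ : s ∈ P'.primeCompl),
      x = algebraMap R K a * (algebraMap R K s)⁻¹) ↔ _
    constructor
    · rintro ⟨a, s, hs, rfl⟩; exact ⟨a, s, hs, rfl⟩
    · rintro ⟨a, s, hs, rfl⟩; exact ⟨a, s, hs, rfl⟩
  have hunit : ∀ s : R, s ∉ P' → O'.valuation (s : K) = 1 := fun s hs => by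
    have hle : O'.valuation (s : K) ≤ 1 := (O'.valuation_le_one_iff _).mpr (hRO s.2)
    exact le_antisymm hle (not_lt.mp fun hlt => hs ((hP' s).mpr hlt))
  have hDO : ∀ d : D, algebraMap D K d ∈ O' := by
    intro d
    obtain ⟨a, s, hs, hd⟩ := (hmemD d).mp d.2
    change (d : K) ∈ O'
    rw [hd]
    refine mul_mem (hRO a.2) ?_
    rw [← O'.valuation_le_one_iff, map_inv₀, hunit s hs, inv_one]
  -- `Spec D` has a resolution of singularities
  have hres : Scheme.HasResolution (Spec (.of D)) := by
    -- a presentation `S[t] ↠ R`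
    obtain ⟨t, ht⟩ := hRfg
    let φ₀ : MvPolynomial t S →ₐ[S] K := MvPolynomial.aeval fun v : t => (v : K)
    have hφ₀ : φ₀.range = R := by
      rw [MvPolynomial.aeval_range, ← ht]
      congr 1
      ext x
      simp
    have hφ₀R : ∀ a, φ₀ a ∈ R := fun a => hφ₀ ▸ ⟨a, rfl⟩
    have hφ₀surj : ∀ r : R, ∃ a, φ₀ a = r := fun r => by
      have hr : (r : K) ∈ φ₀.range := hφ₀ ▸ r.2
      exact hr
    let φR : MvPolynomial t S →+* R := φ₀.toRingHom.codRestrict R hφ₀R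
    have hφR : ∀ a, ((φR a : R) : K) = φ₀ a := fun a => rfl
    -- two extra variables: `A = S[t][Y][X]` mapping to `D` through the constant coefficients
    let cc : (MvPolynomial t S)[X][X] →+* (MvPolynomial t S)[X] := Polynomial.constantCoeff
    let cc' : (MvPolynomial t S)[X] →+* MvPolynomial t S := Polynomial.constantCoeff
    let φp : (MvPolynomial t S)[X][X] →+* D := (algebraMap R D).comp (φR.comp (cc'.comp cc))
    have hφpC : ∀ a₀ : MvPolynomial t S, ∀ a : R, φ₀ a₀ = a →
        φp (C (C a₀)) = algebraMap R D a := by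
      intro a₀ a ha₀
      change algebraMap R D (φR (cc' (cc (C (C a₀))))) = _
      congr 1
      apply Subtype.ext
      rw [hφR]
      simp [cc, cc', ha₀]
    -- every element of `D` is `φp(a) / φp(s)` with `φp(s)` a unit
    have hφ : ∀ d : D, ∃ a s : (MvPolynomial t S)[X][X], IsUnit (φp s) ∧ d * φp s = φp a := by
      intro d
      obtain ⟨⟨a, s⟩, hd⟩ := IsLocalization.mk'_surjective P'.primeCompl d
      dsimp only at hd
      obtain ⟨a₀, ha₀⟩ := hφ₀surj a
      obtain ⟨s₀, hs₀⟩ := hφ₀surj s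
      refine ⟨C (C a₀), C (C s₀), ?_, ?_⟩
      · rw [hφpC s₀ s hs₀]
        exact (IsLocalization.AtPrime.isUnit_to_map_iff D P' (s : R)).mpr s.2
      · rw [hφpC s₀ s hs₀, hφpC a₀ a ha₀, ← hd]
        have := IsLocalization.mk'_spec D a s
        exact this
    -- the primes `(X) ⊂ (X, Y)`
    haveI h𝔭₁ : (RingHom.ker cc).IsPrime := RingHom.ker_isPrime _
    haveI h𝔭₂ : (RingHom.ker (cc'.comp cc)).IsPrime := RingHom.ker_isPrime _
    have h12 : RingHom.ker cc < RingHom.ker (cc'.comp cc) := by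
      refine lt_of_le_of_ne (fun x hx => ?_) (fun h => ?_)
      · change (cc'.comp cc) x = 0
        rw [RingHom.comp_apply, show cc x = 0 from hx, map_zero]
      · have hY : (C X : (MvPolynomial t S)[X][X]) ∈ RingHom.ker (cc'.comp cc) := by
          change cc' (cc (C X)) = 0
          simp [cc, cc']
        rw [← h] at hY
        have : cc (C X) = 0 := hY
        simp [cc] at this
    have h01 : (⊥ : Ideal ((MvPolynomial t S)[X][X])) < RingHom.ker cc := by
      refine bot_lt_iff_ne_bot.mpr fun h => ?_
      have hX : (X : (MvPolynomial t S)[X][X]) ∈ RingHom.ker cc := by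
        change cc X = 0
        simp [cc]
      rw [h] at hX
      exact Polynomial.X_ne_zero ((Submodule.mem_bot _).mp hX)
    have h2k : RingHom.ker (cc'.comp cc) ≤ RingHom.ker φp := by
      intro x hx
      change algebraMap R D (φR ((cc'.comp cc) x)) = 0
      rw [show (cc'.comp cc) x = 0 from hx, map_zero, map_zero]
    haveI : IsDomain (D : Type u) := inferInstance
    exact hasResolution_Spec_of_localization_quotient hCJSE (A := (MvPolynomial t S)[X][X])
      (fun P _ => isExcellentRing_localization_atPrime hS P) φp hφ hdimD h01 h12 h2k
  -- a regular finitely generated model over `D`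
  obtain ⟨T, hT, hTfg, hTreg⟩ := exists_fg_regular_of_hasResolution O' hDO hres
  obtain ⟨g, hg⟩ := hTfg
  -- the model `A₁ = R[g]` (as in `exists_model_regular_of_cjs`)
  have hRT : ∀ z : K, z ∈ R → z ∈ T := fun z hz => by
    have hzD : z ∈ D := (hmemD z).mpr ⟨⟨z, hz⟩, 1, fun h1 => by
      have := (hP' 1).mp h1
      simp at this, by simp⟩
    exact T.algebraMap_mem (⟨z, hzD⟩ : D)
  have hk : ∀ c : S, algebraMap S K c ∈ T := fun c => hRT _ (R.algebraMap_mem c)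
  let Tk : Subalgebra S K := { T.toSubring with algebraMap_mem' := hk }
  have hTk : Tk.toSubring ≤ O'.toSubring := fun z hz => hT hz
  let A₁ : Subalgebra S K := R ⊔ Algebra.adjoin S (g : Set K)
  have hgT : ∀ z ∈ (g : Set K), z ∈ T := fun z hz => by rw [← hg]; exact Algebra.subset_adjoin hz
  have hA₁Tk : A₁ ≤ Tk := sup_le (fun z hz => hRT z hz) (Algebra.adjoin_le fun z hz => hgT z hz)
  have hA₁O : A₁.toSubring ≤ O'.toSubring := fun z hz => hT (hA₁Tk hz)
  have hRA₁ : R ≤ A₁ := le_sup_left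
  refine ⟨A₁, hA₁O, hRA₁, hRfg.sup ⟨g, rfl⟩, ?_⟩
  haveI : IsFractionRing R.toSubring K := ‹IsFractionRing R K›
  haveI : IsFractionRing A₁.toSubring K := isFractionRing_subalgebra_of_le R A₁ hRA₁
  haveI : IsFractionRing Tk.toSubring K :=
    isFractionRing_subalgebra_of_le R Tk (hRA₁.trans hA₁Tk)
  -- `T ⊆ L(A₁)`: `D ⊆ L(R) ⊆ L(A₁)` and `g ⊆ A₁`
  have h1 : (Tk : Set K) ⊆ (Localization.subalgebra.ofField K
      ((maximalIdeal O').comap (Subring.inclusion hA₁O)).primeCompl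
      (Ideal.primeCompl_le_nonZeroDivisors _)) := by
    have hD : (D : Set K) ⊆ (Localization.subalgebra.ofField K
        ((maximalIdeal O').comap (Subring.inclusion hA₁O)).primeCompl
        (Ideal.primeCompl_le_nonZeroDivisors _)) := by
      intro z hz
      obtain ⟨a, s, hs, rfl⟩ := (hmemD z).mp hz
      rw [SetLike.mem_coe, mem_centreLocalization_iff]
      exact ⟨a, hRA₁ a.2, s, hRA₁ s.2, hunit s hs, rfl⟩
    have hTcl : T.toSubring = Subring.closure (Set.range (algebraMap D K) ∪ (g : Set K)) := by
      rw [← hg]; exact Algebra.adjoin_eq_ring_closure _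
    intro z hz
    have hz' : z ∈ T.toSubring := hz
    rw [hTcl] at hz'
    have hsub : Set.range (algebraMap D K) ∪ (g : Set K) ⊆ ((Localization.subalgebra.ofField K
        ((maximalIdeal O').comap (Subring.inclusion hA₁O)).primeCompl
        (Ideal.primeCompl_le_nonZeroDivisors _)).toSubring : Set K) := by
      rintro w (⟨d, rfl⟩ | hw)
      · exact hD d.2
      · exact le_centreLocalization O' A₁ hA₁O
          ((le_sup_right : Algebra.adjoin S (g : Set K) ≤ A₁) (Algebra.subset_adjoin hw))
    exact Subring.closure_le.mpr hsub hz'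
  have h2 : (A₁ : Set K) ⊆ (Localization.subalgebra.ofField K
      ((maximalIdeal O').comap (Subring.inclusion hTk)).primeCompl
      (Ideal.primeCompl_le_nonZeroDivisors _)) :=
    fun z hz => le_centreLocalization O' Tk hTk (hA₁Tk hz)
  have heq : ((Localization.subalgebra.ofField K
      ((maximalIdeal O').comap (Subring.inclusion hA₁O)).primeCompl
      (Ideal.primeCompl_le_nonZeroDivisors _)) : Set K)
      = (Localization.subalgebra.ofField K
      ((maximalIdeal O').comap (Subring.inclusion hTk)).primeCompl
      (Ideal.primeCompl_le_nonZeroDivisors _)) :=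
    le_antisymm (centreLocalization_le O' A₁ Tk hA₁O hTk h2)
      (centreLocalization_le O' Tk A₁ hTk hA₁O h1)
  exact isRegularLocalRing_of_centreLocalization_eq O' A₁ Tk hA₁O hTk heq hTreg

end ModelOfDimLeTwo

end Literature.AlgebraicGeometry.Resolution

end
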